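/-
Copyright: rh-split cell, seat prover-l1 (L1/L19 «DUST WALL»), 2026-08-27.  ζ-free analysis.
Nothing here bears on the truth of RH.
-/
import Summits.RiemannHypothesis.RiemannHypothesis.Theorems.Splittings.ScrewDustCellResidue
import Mathlib.Topology.MetricSpace.ProperSpace.Lemmas
import HarnessLib

/-!
# Flux of a Borel series through a GRID CYCLE: the charge enclosed by a cell complex vanishes

ζ-free kernel piece for the crux `PointComponentInvisible` (route `ScrewDustWall`, X-11 «DUST WALL»,
stmt-RiemannHypothesis-21690): the analogue of `ScrewBorelFlux.tsum_discWeight_eq_zero` (§20, circles)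
for the boundary cycle of a finite union of grid rectangles.

Grid: vertical lines at abscissae `x m` and horizontal lines at ordinates `y n` (`x y : ℤ → ℝ`
non-decreasing); the closed cell `(m, n)` is `[x m, x (m+1)] × [y n, y (n+1)]`.  For a finite set `H` of
cells (a CELL COMPLEX) the EXPOSED edges are the edges of cells of `H` not shared with another cell
of `H`; summing the four-term boundary integrals of the cells of `H`
(`Literature.Analysis.Complex.rectBoundaryIntegral`), the internal edges cancel (§1,
`sum_rectBoundaryIntegral_eq`, pure bookkeeping) and only exposed edges remain.

**Flux theorem** (`cellComplex_charge_eq_zero`, §2).  Let `F` be holomorphic on `𝔻` and equal to the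
Borel series `B = ∑' i, term (c i) (u i)` on a pole-free disc `ball 0 r₀`; let `H` be a cell complex of
closed cells inside `𝔻` such that no pole `u i`, `(u i)⁻¹` lies on an edge of a cell of `H`, and
every exposed edge lies in a preconnected set `V ∋ 0`, `V ⊆ 𝔻 ∖ closure (poleSet u)`.  Then the total
charge enclosed by `H` vanishes: `∑' i, ∑_{Q ∈ H} chargeᵢ(Q°) = 0`, the charge of the term `i` in the
open cell `Q°` being `c i/2 · q` summed over its poles `q ∈ {(u i)⁻¹, u i}` in `Q°`.
Proof: `∑_Q ∮_{∂Q} F = 0` (Cauchy–Goursat per cell); `∑_Q ∮_{∂Q} termᵢ = -2πi ∑_Q chargeᵢ(Q°)`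
(`rectBoundaryIntegral_term`); both sides equal their exposed-edge forms, on exposed edges `F = B`
(identity theorem on `V`, `ScrewBorelFlux.eqOn_of_preconnected`) and `∫ B = ∑' i, ∫ termᵢ`
(`hasSum_intervalIntegral_borel`, the edge being a compact subset of `𝔻 ∖ closure (poleSet u)`).

No `sorry`, no new axioms, no definitions, no instances, no notation.
-/

set_option linter.dupNamespace false

namespace Summit.RiemannHypothesis.RiemannHypothesis.Theorems.Splittings.ScrewDust

open Complex Filter Topology Set Metric MeasureTheory
open scoped Real Interval Classical
open Summit.RiemannHypothesis.RiemannHypothesis.Theorems.Splittings.ScrewBorel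
open Summit.RiemannHypothesis.RiemannHypothesis.Theorems.Splittings.ScrewBorelFlux
open Literature.Analysis.Complex

/-! ## 1. Internal edges cancel -/

/-- Shifting a cell index up is injective. -/
theorem up_injOn (H : Finset (ℤ × ℤ)) :
    Set.InjOn (fun k : ℤ × ℤ ↦ (k.1, k.2 + 1)) H := fun k _ k' _ h ↦ by
  simp only [Prod.mk.injEq, add_left_inj] at h
  exact Prod.ext h.1 h.2

/-- Shifting a cell index to the right is injective. -/
theorem rt_injOn (H : Finset (ℤ × ℤ)) :
    Set.InjOn (fun k : ℤ × ℤ ↦ (k.1 + 1, k.2)) H := fun k _ k' _ h ↦ by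
  simp only [Prod.mk.injEq, add_left_inj] at h
  exact Prod.ext h.1 h.2

/-- `k` is above a cell of `H` iff the cell below `k` is in `H`. -/
theorem mem_image_up {H : Finset (ℤ × ℤ)} {k : ℤ × ℤ} :
    k ∈ H.image (fun k : ℤ × ℤ ↦ (k.1, k.2 + 1)) ↔ (k.1, k.2 - 1) ∈ H := by
  constructor
  · rintro h
    obtain ⟨k', hk', rfl⟩ := Finset.mem_image.1 h
    simpa using hk'
  · intro h
    exact Finset.mem_image.2 ⟨_, h, by simp⟩

/-- `k` is right of a cell of `H` iff the cell left of `k` is in `H`. -/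
theorem mem_image_rt {H : Finset (ℤ × ℤ)} {k : ℤ × ℤ} :
    k ∈ H.image (fun k : ℤ × ℤ ↦ (k.1 + 1, k.2)) ↔ (k.1 - 1, k.2) ∈ H := by
  constructor
  · rintro h
    obtain ⟨k', hk', rfl⟩ := Finset.mem_image.1 h
    simpa using hk'
  · intro h
    exact Finset.mem_image.2 ⟨_, h, by simp⟩

/-- **Edge form of the total boundary integral.**  Summing the four-term boundary integrals of the cells
of a cell complex `H`, only EXPOSED edges survive: bottom edges of cells with no cell of `H` below, top
edges with none above (minus sign), right edges with none to the right, left edges with none to the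
left (minus sign).  Pure bookkeeping, valid for every integrand and every grid `x, y : ℤ → ℝ`. -/
theorem sum_rectBoundaryIntegral_eq (g : ℂ → ℂ) (x y : ℤ → ℝ) (H : Finset (ℤ × ℤ)) :
    ∑ k ∈ H, rectBoundaryIntegral g (x k.1) (x (k.1 + 1)) (y k.2) (y (k.2 + 1)) =
      ((∑ k ∈ H \ H.image (fun k : ℤ × ℤ ↦ (k.1, k.2 + 1)),
          ∫ t in x k.1..x (k.1 + 1), g (t + y k.2 * I)) -
        ∑ k ∈ H.image (fun k : ℤ × ℤ ↦ (k.1, k.2 + 1)) \ H,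
          ∫ t in x k.1..x (k.1 + 1), g (t + y k.2 * I)) +
      I * ((∑ k ∈ H.image (fun k : ℤ × ℤ ↦ (k.1 + 1, k.2)) \ H,
          ∫ t in y k.2..y (k.2 + 1), g (x k.1 + t * I)) -
        ∑ k ∈ H \ H.image (fun k : ℤ × ℤ ↦ (k.1 + 1, k.2)),
          ∫ t in y k.2..y (k.2 + 1), g (x k.1 + t * I)) := by
  have e : ∀ k : ℤ × ℤ, rectBoundaryIntegral g (x k.1) (x (k.1 + 1)) (y k.2) (y (k.2 + 1)) =
      (∫ t in x k.1..x (k.1 + 1), g (t + y k.2 * I)) -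
        (∫ t in x k.1..x (k.1 + 1), g (t + y (k.2 + 1) * I)) +
      (I * (∫ t in y k.2..y (k.2 + 1), g (x (k.1 + 1) + t * I)) -
        I * ∫ t in y k.2..y (k.2 + 1), g (x k.1 + t * I)) := fun k ↦ by
    simp only [rectBoundaryIntegral]
    ring
  have s1 : ∑ k ∈ H, (∫ t in x k.1..x (k.1 + 1), g (t + y (k.2 + 1) * I)) =
      ∑ k ∈ H.image (fun k : ℤ × ℤ ↦ (k.1, k.2 + 1)), ∫ t in x k.1..x (k.1 + 1), g (t + y k.2 * I) := by
    rw [Finset.sum_image (up_injOn H)]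
  have s2 : ∑ k ∈ H, (∫ t in y k.2..y (k.2 + 1), g (x (k.1 + 1) + t * I)) =
      ∑ k ∈ H.image (fun k : ℤ × ℤ ↦ (k.1 + 1, k.2)), ∫ t in y k.2..y (k.2 + 1), g (x k.1 + t * I) := by
    rw [Finset.sum_image (rt_injOn H)]
  simp only [e, Finset.sum_add_distrib, Finset.sum_sub_distrib, ← Finset.mul_sum]
  rw [s1, s2, Finset.sum_sdiff_sub_sum_sdiff, Finset.sum_sdiff_sub_sum_sdiff]
  ring

/-! ## 2. The flux theorem for cell complexes -/

/-- Termwise integration of the Borel series along a path segment inside a preconnected `V ∋ 0`,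
`V ⊆ 𝔻 ∖ closure (poleSet u)`, on which `F = B`: `∑' i, ∫ termᵢ ∘ γ = ∫ F ∘ γ`. -/
theorem hasSum_integral_path {ι : Type*} [Countable ι] {c u : ι → ℂ}
    (hc : Summable fun i ↦ ‖c i‖) (hu : ∀ i, u i ≠ 0) {F : ℂ → ℂ}
    (hF : DifferentiableOn ℂ F (ball 0 1)) {r₀ : ℝ} (hr₀ : 0 < r₀)
    (hFB : EqOn F (fun z ↦ ∑' i, term (c i) (u i) z) (ball 0 r₀)) {V : Set ℂ}
    (hV : IsPreconnected V) (hV0 : (0 : ℂ) ∈ V) (hVsub : V ⊆ ball 0 1 \ closure (poleSet u))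
    {γ : ℝ → ℂ} (hγ : Continuous γ) {s t : ℝ} (hst : s ≤ t) (hγV : ∀ r ∈ Icc s t, γ r ∈ V) :
    HasSum (fun i ↦ ∫ r in s..t, term (c i) (u i) (γ r)) (∫ r in s..t, F (γ r)) := by
  -- the compact trace of the segment, its norm bound and its separation from the pole set
  have hK : IsCompact (γ '' Icc s t) := isCompact_Icc.image hγ
  have hKV : γ '' Icc s t ⊆ V := by rintro _ ⟨r, hr, rfl⟩; exact hγV r hr
  obtain ⟨r', hr'1, hKr'⟩ : ∃ r' < 1, γ '' Icc s t ⊆ ball (0 : ℂ) r' :=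
    exists_lt_subset_ball hK.isClosed fun z hz ↦ (hVsub (hKV hz)).1
  have hdisj : Disjoint (γ '' Icc s t) (closure (poleSet u)) :=
    Set.disjoint_left.2 fun z hz hzcl ↦ (hVsub (hKV hz)).2 hzcl
  obtain ⟨δ₁, hδ₁, hsep⟩ := exists_separation hK hdisj
  set δ₂ : ℝ := min δ₁ (1 - r') with hδ₂
  have hδ₂0 : 0 < δ₂ := lt_min hδ₁ (by linarith)
  have hδ₂r : δ₂ ≤ 1 - r' := min_le_right _ _
  have hzr : ∀ r ∈ Icc s t, ‖γ r‖ ≤ r' := fun r hr ↦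
    (mem_ball_zero_iff.1 (hKr' ⟨r, hr, rfl⟩)).le
  have hfar : ∀ r ∈ Icc s t, ∀ q ∈ poleSet u, δ₂ ≤ ‖q - γ r‖ := fun r hr q hq ↦
    (min_le_left _ _).trans (hsep _ ⟨r, hr, rfl⟩ q hq)
  have h := hasSum_intervalIntegral_borel hc hu hγ hst hδ₂0 hδ₂r hzr hfar
  have hFBV := eqOn_of_preconnected hc hu hF hr₀ hFB hV hV0 hVsub
  have e : (∫ r in s..t, ∑' i, term (c i) (u i) (γ r)) = ∫ r in s..t, F (γ r) := by
    refine intervalIntegral.integral_congr fun r hr ↦ ?_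
    rw [uIcc_of_le hst] at hr
    exact (hFBV (hγV r hr)).symm
  rwa [e] at h

/-- **Flux theorem for cell complexes (ζ-free).**  `c` absolutely summable, `u i ≠ 0`, `F` holomorphic
on the unit disc and equal to the Borel series on a pole-free disc `ball 0 r₀`; a grid `x, y : ℤ → ℝ`
(non-decreasing) and a finite set `H` of its cells `[x m, x (m+1)] × [y n, y (n+1)]`, closed cells inside
`𝔻`, no pole `u i`, `(u i)⁻¹` on an edge of a cell of `H` (each pole is in the open cell or off the
closed cell), and every EXPOSED edge (bottom edge of a cell of `H` with no cell of `H` below it, etc.)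
inside a preconnected `V ∋ 0`, `V ⊆ 𝔻 ∖ closure (poleSet u)`.  Then the total charge enclosed by `H`
vanishes. -/
theorem cellComplex_charge_eq_zero {ι : Type*} [Countable ι] {c u : ι → ℂ}
    (hc : Summable fun i ↦ ‖c i‖) (hu : ∀ i, u i ≠ 0) {F : ℂ → ℂ}
    (hF : DifferentiableOn ℂ F (ball 0 1)) {r₀ : ℝ} (hr₀ : 0 < r₀)
    (hFB : EqOn F (fun z ↦ ∑' i, term (c i) (u i) z) (ball 0 r₀)) {V : Set ℂ}
    (hV : IsPreconnected V) (hV0 : (0 : ℂ) ∈ V) (hVsub : V ⊆ ball 0 1 \ closure (poleSet u))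
    {x y : ℤ → ℝ} (hx : ∀ m, x m ≤ x (m + 1)) (hy : ∀ n, y n ≤ y (n + 1)) (H : Finset (ℤ × ℤ))
    (hH : ∀ k ∈ H, Icc (x k.1) (x (k.1 + 1)) ×ℂ Icc (y k.2) (y (k.2 + 1)) ⊆ ball (0 : ℂ) 1)
    (hoff : ∀ i, ∀ k ∈ H, ∀ q : ℂ, q = u i ∨ q = (u i)⁻¹ →
      q ∈ Ioo (x k.1) (x (k.1 + 1)) ×ℂ Ioo (y k.2) (y (k.2 + 1)) ∨
        q ∉ Icc (x k.1) (x (k.1 + 1)) ×ℂ Icc (y k.2) (y (k.2 + 1)))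
    (hbot : ∀ k ∈ H, (k.1, k.2 - 1) ∉ H →
      (fun t : ℝ ↦ (t : ℂ) + y k.2 * I) '' Icc (x k.1) (x (k.1 + 1)) ⊆ V)
    (htop : ∀ k ∈ H, (k.1, k.2 + 1) ∉ H →
      (fun t : ℝ ↦ (t : ℂ) + y (k.2 + 1) * I) '' Icc (x k.1) (x (k.1 + 1)) ⊆ V)
    (hlef : ∀ k ∈ H, (k.1 - 1, k.2) ∉ H →
      (fun t : ℝ ↦ (x k.1 : ℂ) + t * I) '' Icc (y k.2) (y (k.2 + 1)) ⊆ V)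
    (hrig : ∀ k ∈ H, (k.1 + 1, k.2) ∉ H →
      (fun t : ℝ ↦ (x (k.1 + 1) : ℂ) + t * I) '' Icc (y k.2) (y (k.2 + 1)) ⊆ V) :
    ∑' i, ∑ k ∈ H, ((if (u i)⁻¹ ∈ Ioo (x k.1) (x (k.1 + 1)) ×ℂ Ioo (y k.2) (y (k.2 + 1))
        then c i / 2 * (u i)⁻¹ else 0) +
      (if u i ∈ Ioo (x k.1) (x (k.1 + 1)) ×ℂ Ioo (y k.2) (y (k.2 + 1)) then c i / 2 * u i else 0)) =
      0 := by
  -- (1) the cells: Cauchy–Goursat for `F`, residues for the terms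
  have hF0 : ∑ k ∈ H, rectBoundaryIntegral F (x k.1) (x (k.1 + 1)) (y k.2) (y (k.2 + 1)) = 0 :=
    Finset.sum_eq_zero fun k hk ↦ rectBoundaryIntegral_eq_zero_of_subset_ball hF
      (hx _) (hy _) (hH k hk)
  have hT : ∀ i, ∑ k ∈ H, rectBoundaryIntegral (term (c i) (u i)) (x k.1) (x (k.1 + 1)) (y k.2)
      (y (k.2 + 1)) = -(2 * π * I) * ∑ k ∈ H,
      ((if (u i)⁻¹ ∈ Ioo (x k.1) (x (k.1 + 1)) ×ℂ Ioo (y k.2) (y (k.2 + 1))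
        then c i / 2 * (u i)⁻¹ else 0) +
      (if u i ∈ Ioo (x k.1) (x (k.1 + 1)) ×ℂ Ioo (y k.2) (y (k.2 + 1)) then c i / 2 * u i else 0)) := by
    intro i
    rw [Finset.mul_sum]
    refine Finset.sum_congr rfl fun k hk ↦ ?_
    exact rectBoundaryIntegral_term (hu i) (hx _) (hy _) (hH k hk)
      (hoff i k hk _ (Or.inl rfl)) (hoff i k hk _ (Or.inr rfl))
  -- (2) exposed edges: termwise integration and `F = B`
  have hb : ∀ k ∈ H \ H.image (fun k : ℤ × ℤ ↦ (k.1, k.2 + 1)),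
      HasSum (fun i ↦ ∫ t in x k.1..x (k.1 + 1), term (c i) (u i) (t + y k.2 * I))
        (∫ t in x k.1..x (k.1 + 1), F (t + y k.2 * I)) := by
    intro k hk
    rw [Finset.mem_sdiff, mem_image_up] at hk
    have hsub := hbot k hk.1 hk.2
    exact hasSum_integral_path hc hu hF hr₀ hFB hV hV0 hVsub (γ := fun t : ℝ ↦ (t : ℂ) + y k.2 * I)
      (by fun_prop) (hx _) fun t ht ↦ hsub ⟨t, ht, rfl⟩
  have ht : ∀ k ∈ H.image (fun k : ℤ × ℤ ↦ (k.1, k.2 + 1)) \ H,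
      HasSum (fun i ↦ ∫ t in x k.1..x (k.1 + 1), term (c i) (u i) (t + y k.2 * I))
        (∫ t in x k.1..x (k.1 + 1), F (t + y k.2 * I)) := by
    intro k hk
    rw [Finset.mem_sdiff] at hk
    obtain ⟨k', hk', rfl⟩ := Finset.mem_image.1 hk.1
    have hsub := htop k' hk' hk.2
    exact hasSum_integral_path hc hu hF hr₀ hFB hV hV0 hVsub
      (γ := fun t : ℝ ↦ (t : ℂ) + y (k'.2 + 1) * I)
      (by fun_prop) (hx _) fun t ht ↦ hsub ⟨t, ht, rfl⟩
  have hr : ∀ k ∈ H.image (fun k : ℤ × ℤ ↦ (k.1 + 1, k.2)) \ H,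
      HasSum (fun i ↦ ∫ t in y k.2..y (k.2 + 1), term (c i) (u i) (x k.1 + t * I))
        (∫ t in y k.2..y (k.2 + 1), F (x k.1 + t * I)) := by
    intro k hk
    rw [Finset.mem_sdiff] at hk
    obtain ⟨k', hk', rfl⟩ := Finset.mem_image.1 hk.1
    have hsub := hrig k' hk' hk.2
    exact hasSum_integral_path hc hu hF hr₀ hFB hV hV0 hVsub
      (γ := fun t : ℝ ↦ (x (k'.1 + 1) : ℂ) + t * I)
      (by fun_prop) (hy _) fun t ht ↦ hsub ⟨t, ht, rfl⟩
  have hl : ∀ k ∈ H \ H.image (fun k : ℤ × ℤ ↦ (k.1 + 1, k.2)),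
      HasSum (fun i ↦ ∫ t in y k.2..y (k.2 + 1), term (c i) (u i) (x k.1 + t * I))
        (∫ t in y k.2..y (k.2 + 1), F (x k.1 + t * I)) := by
    intro k hk
    rw [Finset.mem_sdiff, mem_image_rt] at hk
    have hsub := hlef k hk.1 hk.2
    exact hasSum_integral_path hc hu hF hr₀ hFB hV hV0 hVsub
      (γ := fun t : ℝ ↦ (x k.1 : ℂ) + t * I)
      (by fun_prop) (hy _) fun t ht ↦ hsub ⟨t, ht, rfl⟩
  -- (3) the edge forms: `∑' i, (edge form of termᵢ) = edge form of F = ∑_Q ∮ F = 0`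
  have hE : HasSum (fun i ↦ ∑ k ∈ H, rectBoundaryIntegral (term (c i) (u i)) (x k.1) (x (k.1 + 1))
      (y k.2) (y (k.2 + 1)))
      (∑ k ∈ H, rectBoundaryIntegral F (x k.1) (x (k.1 + 1)) (y k.2) (y (k.2 + 1))) := by
    simp only [sum_rectBoundaryIntegral_eq]
    exact ((hasSum_sum hb).sub (hasSum_sum ht)).add
      (((hasSum_sum hr).sub (hasSum_sum hl)).mul_left I)
  simp only [hT, hF0] at hE
  have h3 := hE.tsum_eq
  rw [tsum_mul_left] at h3
  have h2pi : -(2 * π * I : ℂ) ≠ 0 := by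
    refine neg_ne_zero.2 (mul_ne_zero (mul_ne_zero two_ne_zero ?_) I_ne_zero)
    exact_mod_cast Real.pi_ne_zero
  exact (mul_eq_zero.1 h3).resolve_left h2pi

end Summit.RiemannHypothesis.RiemannHypothesis.Theorems.Splittings.ScrewDust
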